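import Summits.AtomisticToContinuum.BoseEinsteinCondensation.Theorems.BECConjugateDominationHardCoreExtensionAlphaSoft
import Summits.AtomisticToContinuum.BoseEinsteinCondensation.Theorems.BECConjugateDominationHardCoreExtensionAlphaSoftPair
import Summits.AtomisticToContinuum.BoseEinsteinCondensation.Theorems.BECConjugateDominationHardCoreExtensionKineticTightness
import Summits.AtomisticToContinuum.BoseEinsteinCondensation.Theorems.BECConjugateDominationHardCoreExtensionPairKineticTightness
import Summits.AtomisticToContinuum.BoseEinsteinCondensation.Theorems.BECConjugateDominationHardCoreExtensionPairShellMassUniform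
import HarnessLib

/-!
# Truncation convergence at SOFT cores — UNCONDITIONAL: the ground-state level (α') and the Ky Fan two-level (α'₂)
# (line `third-law-current-floor`, crux `HardCoreExtension`, stmt-AtomisticToContinuum-11786, lead c1, cycle 2)

The two composition nodes of the soft-core class — `stub_truncationEnergyConvergenceSoft_of` (…AlphaSoft.lean: E2U → P3 → P4U → (α'))
and `stub_truncationKyFanConvergenceSoft_of` (…AlphaSoftPair.lean: pair tightness → P4U → (α'₂)) — fed with the landed analytic inputs
E2U `stub_pairCutoffExistsUniform`, P3 `stub_truncationMinimisersKineticTightness`, P4U `stub_pairShellMassBoundUniform`, and the pair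
tightness `stub_pairKineticTightness_of ∘ stub_traceCauchy_of ∘ stub_gramSchmidtPair`. Registered: `stub_truncationEnergyConvergenceSoft`,
`stub_truncationKyFanConvergenceSoft`. [folklore; the Lean route is new]
-/

noncomputable section

namespace Summit.AtomisticToContinuum.BoseEinsteinCondensation.Cruxes.HardCoreExtension.ThirdLawCurrentFloor

open MeasureTheory Filter
open scoped ENNReal NNReal BigOperators Topology
open Literature.MathematicalPhysics.QuantumManyBody.BoseGas

/-- **(α') on the soft-core class, unconditional (registered `stub_truncationEnergyConvergenceSoft`).** [folklore] -/
theorem stub_truncationEnergyConvergenceSoft :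
    ∀ (v : ℝ → ℝ≥0∞) (a a₀ : ℝ), IsRepulsiveFiniteRange v → 0 ≤ a → 0 < a₀ →
          (∀ δ : ℝ, 0 < δ → δ ≤ a₀ → ∃ M : ℝ≥0∞, M ≠ ⊤ ∧ ∀ r, a + δ < r → v r ≤ M) →
          (∀ (C δ₁ : ℝ), 0 < δ₁ → ∃ δ : ℝ, 0 < δ ∧ δ ≤ δ₁ ∧ δ ≤ a₀ ∧
            ∀ r, 0 ≤ r → r < a + δ → ENNReal.ofReal (C / δ ^ 2) ≤ v r) →
          ∀ (N : ℕ) (L : ℝ), 4 * (a + a₀) < L → periodicGroundStateEnergy v N L ≠ ⊤ →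
          ∀ ε : ℝ, 0 < ε → ∃ n₀ : ℕ, ∀ n : ℕ, n₀ ≤ n →
            periodicGroundStateEnergy v N L ≤
              periodicGroundStateEnergy (fun r => min (v r) (n : ℝ≥0∞)) N L + ENNReal.ofReal ε :=
  stub_truncationEnergyConvergenceSoft_of stub_pairCutoffExistsUniform stub_truncationMinimisersKineticTightness
    stub_pairShellMassBoundUniform

/-- **(α'₂) on the soft-core class, unconditional (registered `stub_truncationKyFanConvergenceSoft`).** [folklore] -/
theorem stub_truncationKyFanConvergenceSoft :
    ∀ (v : ℝ → ℝ≥0∞) (a a₀ : ℝ), IsRepulsiveFiniteRange v → 0 ≤ a → 0 < a₀ →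
          (∀ δ : ℝ, 0 < δ → δ ≤ a₀ → ∃ M : ℝ≥0∞, M ≠ ⊤ ∧ ∀ r, a + δ < r → v r ≤ M) →
          (∀ (C δ₁ : ℝ), 0 < δ₁ → ∃ δ : ℝ, 0 < δ ∧ δ ≤ δ₁ ∧ δ ≤ a₀ ∧
            ∀ r, 0 ≤ r → r < a + δ → ENNReal.ofReal (C / δ ^ 2) ≤ v r) →
          ∀ (N : ℕ) (L : ℝ), 4 * (a + a₀) < L → kyFanTwo v N L ≠ ⊤ →
          ∀ ε : ℝ, 0 < ε → ∃ n₀ : ℕ, ∀ n : ℕ, n₀ ≤ n →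
            kyFanTwo v N L ≤ kyFanTwo (fun r => min (v r) (n : ℝ≥0∞)) N L + ENNReal.ofReal ε :=
  stub_truncationKyFanConvergenceSoft_of (stub_pairKineticTightness_of (stub_traceCauchy_of stub_gramSchmidtPair))
    stub_pairShellMassBoundUniform

end Summit.AtomisticToContinuum.BoseEinsteinCondensation.Cruxes.HardCoreExtension.ThirdLawCurrentFloor

end
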